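import Mathlib
import HarnessLib

/-!
# Harmonic rigidity (stub D of crux `DressedCharge`) — constant-coefficient derivations

Helper file for stub `stub_harmonicSymmetries` (D) of line `birth` of the crux
`Summit.AtomisticToContinuum.FouriersLaw.Theses.HiddenChargeMazur.DressedCharge`
(item stmt-AtomisticToContinuum-13509, route `HiddenChargeMazur`); a `--supports` file, it closes
no item by itself.

Generic algebra of derivations of a polynomial ring `MvPolynomial σ ℂ` whose values on the
generators are constants (`D (X i) = C (v i)`):
* such a derivation is the combination `∑ v y • ∂_y` of partial derivatives over the (finitely
  many) variables of its argument, hence lowers the degree of a homogeneous polynomial by one;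
* in characteristic zero a polynomial all of whose partial derivatives vanish is a constant;
* a finite Laurent sum `∑_{x ∈ S} c_x z^x` (`S ⊂ ℤ` finite) vanishing at infinitely many
  `z ∈ ℂˣ` has all coefficients zero (also coefficientwise for polynomial-valued `c`);
* consequently (the key rigidity step of stub D): if the complex plane-wave derivations
  `D_(z,μ) = mkDerivation (q_x ↦ z^x, p_x ↦ μ z^x)` of the lattice phase-space ring
  `MvPolynomial (ℤ ⊕ ℤ) ℂ` kill `U` for all `z` outside a finite set and all `μ` on the dispersion
  curve `μ² = -(ω + 2 - z - z⁻¹)`, then `U` is a constant.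
No Fourier analysis, no plane-wave calculus beyond `mkDerivation_X`.
-/

noncomputable section

open MvPolynomial Finsupp
open scoped BigOperators

namespace Summit.AtomisticToContinuum.FouriersLaw.Theorems.DressedCharge

variable {σ : Type*}

/-- A finite sum of derivations acts termwise: `(∑ D_i) f = ∑ D_i f`. [folklore] -/
theorem derivation_finset_sum_apply {ι : Type*} (s : Finset ι)
    (D : ι → Derivation ℂ (MvPolynomial σ ℂ) (MvPolynomial σ ℂ)) (f : MvPolynomial σ ℂ) :
    (∑ i ∈ s, D i) f = ∑ i ∈ s, D i f := by
  have h := map_sum (Derivation.coeFnAddMonoidHom) D s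
  simp only [Derivation.coeFnAddMonoidHom_apply] at h
  rw [h, Finset.sum_apply]

/-- A derivation of `MvPolynomial σ ℂ` with constant values `D (X i) = C (v i)` on the generators
is the combination `∑_{y ∈ vars f} v y • ∂_y f` of partial derivatives. [folklore] -/
theorem derivation_eq_sum_pderiv (D : Derivation ℂ (MvPolynomial σ ℂ) (MvPolynomial σ ℂ))
    (v : σ → ℂ) (hD : ∀ i, D (X i) = C (v i)) (f : MvPolynomial σ ℂ) :
    D f = ∑ y ∈ f.vars, v y • pderiv y f := by
  classical
  have key : D f = (∑ y ∈ f.vars, v y • pderiv y) f := by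
    refine derivation_eq_of_forall_mem_vars (fun i hi => ?_)
    rw [hD, derivation_finset_sum_apply]
    simp only [Derivation.smul_apply]
    rw [Finset.sum_eq_single i, pderiv_X_self, C_eq_smul_one]
    · intro j _ hji
      rw [pderiv_X_of_ne (Ne.symm hji), smul_zero]
    · intro hi'
      exact absurd hi hi'
  rw [key, derivation_finset_sum_apply]
  simp only [Derivation.smul_apply]

/-- A derivation with constant values on the generators maps a homogeneous polynomial of degree
`d` to a homogeneous polynomial of degree `d - 1`. [folklore] -/
theorem isHomogeneous_derivation_of_const (D : Derivation ℂ (MvPolynomial σ ℂ) (MvPolynomial σ ℂ))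
    (v : σ → ℂ) (hD : ∀ i, D (X i) = C (v i)) {f : MvPolynomial σ ℂ} {d : ℕ}
    (hf : f.IsHomogeneous d) : (D f).IsHomogeneous (d - 1) := by
  rw [derivation_eq_sum_pderiv D v hD f]
  refine IsHomogeneous.sum _ _ _ (fun y _ => ?_)
  rw [smul_eq_C_mul]
  exact hf.pderiv.C_mul _

/-- A homogeneous polynomial of degree `0` is the constant `C (constantCoeff f)`. [folklore] -/
theorem eq_C_of_isHomogeneous_zero {f : MvPolynomial σ ℂ} (hf : f.IsHomogeneous 0) :
    f = C (constantCoeff f) := by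
  rw [← totalDegree_zero_iff_isHomogeneous, totalDegree_eq_zero_iff_eq_C] at hf
  rw [constantCoeff_eq]
  exact hf

/-- A homogeneous polynomial of positive degree has vanishing constant coefficient, so if it is a
constant it vanishes. [folklore] -/
theorem eq_zero_of_isHomogeneous_of_eq_C {f : MvPolynomial σ ℂ} {d : ℕ} (hf : f.IsHomogeneous d)
    (hd : d ≠ 0) (h : f = C (constantCoeff f)) : f = 0 := by
  have h0 : constantCoeff f = 0 := by
    rw [constantCoeff_eq]
    exact hf.coeff_eq_zero (by rw [map_zero]; exact fun h => hd h.symm)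
  rw [h, h0, C_0]

/-- In characteristic zero, a polynomial all of whose partial derivatives vanish is the constant
`C (constantCoeff f)` (coefficient extraction `coeff m (∂_i f) = (m i + 1) coeff (m + e_i) f`).
[folklore] -/
theorem eq_C_of_pderiv_eq_zero (f : MvPolynomial σ ℂ) (h : ∀ i, pderiv i f = 0) :
    f = C (constantCoeff f) := by
  classical
  ext m
  rw [coeff_C]
  split_ifs with hm
  · subst hm
    rfl
  · obtain ⟨i, hi⟩ : ∃ i, m i ≠ 0 := by
      by_contra hcon
      push Not at hcon
      exact hm (Finsupp.ext fun i => by rw [hcon i]; rfl)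
    have key := coeff_pderiv (i := i) f (m - single i 1)
    rw [h i, coeff_zero, tsub_add_cancel_of_le
      (Finsupp.single_le_iff.mpr (Nat.one_le_iff_ne_zero.mpr hi))] at key
    exact (mul_eq_zero.mp key.symm).resolve_right (Nat.cast_add_one_ne_zero _)

/-- **Laurent zero lemma.** A finite Laurent sum `∑_{x ∈ S} c_x z^x` vanishing at infinitely many
nonzero complex `z` has all its coefficients equal to zero (shift the exponents into `ℕ` and use
that a nonzero polynomial has finitely many roots). [folklore] -/
theorem laurent_coeff_eq_zero (S : Finset ℤ) (c : ℤ → ℂ)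
    (h : {z : ℂ | z ≠ 0 ∧ ∑ x ∈ S, c x * z ^ x = 0}.Infinite) : ∀ x ∈ S, c x = 0 := by
  classical
  obtain ⟨N, hN⟩ : ∃ N : ℕ, ∀ x ∈ S, 0 ≤ x + N := by
    refine ⟨S.sup fun x => (-x).toNat, fun x hx => ?_⟩
    have h1 : (-x).toNat ≤ S.sup fun x => (-x).toNat :=
      Finset.le_sup (f := fun x => (-x).toNat) hx
    have h2 : -x ≤ ((-x).toNat : ℤ) := Int.self_le_toNat (-x)
    omega
  set Q : Polynomial ℂ := ∑ x ∈ S, Polynomial.C (c x) * Polynomial.X ^ (x + N).toNat with hQ_def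
  have hQeval : ∀ z : ℂ, z ≠ 0 → Q.eval z = z ^ N * ∑ x ∈ S, c x * z ^ x := by
    intro z hz
    rw [hQ_def, Polynomial.eval_finsetSum, Finset.mul_sum]
    refine Finset.sum_congr rfl (fun x hx => ?_)
    rw [Polynomial.eval_mul, Polynomial.eval_C, Polynomial.eval_pow, Polynomial.eval_X,
      ← zpow_natCast, Int.toNat_of_nonneg (hN x hx), zpow_add₀ hz, zpow_natCast]
    ring
  have hQ : Q = 0 := by
    apply Polynomial.eq_zero_of_infinite_isRoot
    refine h.mono ?_
    rintro z ⟨hz, hsum⟩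
    show Q.IsRoot z
    rw [Polynomial.IsRoot.def, hQeval z hz, hsum, mul_zero]
  intro x hx
  have hcoeff := congrArg (fun P : Polynomial ℂ => P.coeff (x + N).toNat) hQ
  simp only [hQ_def, Polynomial.finsetSum_coeff, Polynomial.coeff_C_mul, Polynomial.coeff_X_pow,
    Polynomial.coeff_zero] at hcoeff
  rw [Finset.sum_eq_single x] at hcoeff
  · simpa using hcoeff
  · intro y hy hyx
    have hne : (x + N).toNat ≠ (y + N).toNat := by
      intro heq
      apply hyx
      have := hN y hy
      have := hN x hx
      omega
    simp [hne]
  · intro hx'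
    exact absurd hx hx'

/-- Polynomial-valued Laurent zero lemma: if `∑_{x ∈ S} z^x • V x = 0` for infinitely many nonzero
`z`, then every `V x`, `x ∈ S`, vanishes (apply `laurent_coeff_eq_zero` coefficientwise).
[folklore] -/
theorem laurent_smul_eq_zero (S : Finset ℤ) (V : ℤ → MvPolynomial σ ℂ)
    (h : {z : ℂ | z ≠ 0 ∧ ∑ x ∈ S, z ^ x • V x = 0}.Infinite) : ∀ x ∈ S, V x = 0 := by
  intro x hx
  ext m
  rw [coeff_zero]
  refine laurent_coeff_eq_zero S (fun y => coeff m (V y)) (h.mono ?_) x hx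
  rintro z ⟨hz, hsum⟩
  refine ⟨hz, ?_⟩
  have hc := congrArg (coeff m) hsum
  rw [coeff_sum, coeff_zero] at hc
  simp only [coeff_smul, smul_eq_mul] at hc
  rw [← hc]
  exact Finset.sum_congr rfl (fun y _ => mul_comm _ _)

/-- **Key rigidity step.** If the plane-wave derivations
`D_(z,μ) = mkDerivation ℂ (q_x ↦ C z^x, p_x ↦ C (μ z^x))` of `MvPolynomial (ℤ ⊕ ℤ) ℂ` annihilate
`U` for every `z ≠ 0` outside a finite set `F` and every `μ` with `μ² = -(ω + 2 - z - z⁻¹)`, then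
`U` is a constant.  Proof: `D_(z,μ) U = A(z) + μ • B(z)` with `A(z) = ∑ z^x • ∂_{q_x} U`,
`B(z) = ∑ z^x • ∂_{p_x} U`; off the two zeros of `z² - (ω+2)z + 1` both signs `±μ ≠ 0` are
allowed, so `A(z) = B(z) = 0` for infinitely many `z`, whence every partial derivative of `U`
vanishes by the Laurent zero lemma. [folklore] -/
theorem eq_C_of_planeWave_eq_zero (ω : ℂ) (U : MvPolynomial (ℤ ⊕ ℤ) ℂ) (F : Finset ℂ)
    (h : ∀ z μ : ℂ, z ≠ 0 → z ∉ F → μ ^ 2 = -(ω + 2 - z - z⁻¹) →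
      mkDerivation ℂ (Sum.elim (fun x : ℤ => (C (z ^ x) : MvPolynomial (ℤ ⊕ ℤ) ℂ))
        (fun x : ℤ => C (μ * z ^ x))) U = 0) :
    U = C (constantCoeff U) := by
  classical
  set q : Polynomial ℂ := Polynomial.X ^ 2 - Polynomial.C (ω + 2) * Polynomial.X + 1 with hq_def
  have hq0 : q ≠ 0 := by
    intro h0
    have h00 := congrArg (fun P : Polynomial ℂ => P.coeff 0) h0
    simp [hq_def] at h00
  set bad : Finset ℂ := F ∪ {0} ∪ q.roots.toFinset with hbad
  have hgood : ∀ z, z ∉ bad → z ≠ 0 ∧ z ∉ F ∧ -(ω + 2 - z - z⁻¹) ≠ 0 := by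
    intro z hz
    simp only [hbad, Finset.mem_union, Finset.mem_singleton, Multiset.mem_toFinset,
      Polynomial.mem_roots hq0, Polynomial.IsRoot.def, not_or] at hz
    obtain ⟨⟨hzF, hz0⟩, hzq⟩ := hz
    refine ⟨hz0, hzF, ?_⟩
    have hqz : q.eval z = z ^ 2 - (ω + 2) * z + 1 := by simp [hq_def]
    have hid : z ^ 2 - (ω + 2) * z + 1 = z * (-(ω + 2 - z - z⁻¹)) := by
      field_simp
      ring
    intro hω
    apply hzq
    rw [hqz, hid, hω, mul_zero]
  -- the plane-wave derivation splits into a `q`-part and `μ` times a `p`-part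
  have hexp : ∀ z μ : ℂ,
      mkDerivation ℂ (Sum.elim (fun x : ℤ => (C (z ^ x) : MvPolynomial (ℤ ⊕ ℤ) ℂ))
        (fun x : ℤ => C (μ * z ^ x))) U =
      (∑ a ∈ U.vars.toLeft, z ^ a • pderiv (Sum.inl a) U) +
        μ • ∑ b ∈ U.vars.toRight, z ^ b • pderiv (Sum.inr b) U := by
    intro z μ
    rw [derivation_eq_sum_pderiv _ (Sum.elim (fun x : ℤ => z ^ x) (fun x : ℤ => μ * z ^ x)) ?_ U]
    · rw [Finset.sum_sum_eq_sum_toLeft_add_sum_toRight]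
      simp only [Sum.elim_inl, Sum.elim_inr, mul_smul, ← Finset.smul_sum]
    · intro i
      rw [mkDerivation_X]
      cases i <;> rfl
  have hvan : ∀ z, z ∉ bad →
      (∑ a ∈ U.vars.toLeft, z ^ a • pderiv (Sum.inl a) U) = 0 ∧
        (∑ b ∈ U.vars.toRight, z ^ b • pderiv (Sum.inr b) U) = 0 := by
    intro z hz
    obtain ⟨hz0, hzF, hω⟩ := hgood z hz
    obtain ⟨μ, hμ⟩ := IsAlgClosed.exists_pow_nat_eq (-(ω + 2 - z - z⁻¹)) two_pos
    have hμ0 : μ ≠ 0 := by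
      rintro rfl
      apply hω
      rw [← hμ]
      ring
    have h1 := h z μ hz0 hzF hμ
    have h2 := h z (-μ) hz0 hzF (by rw [neg_sq, hμ])
    rw [hexp] at h1 h2
    have h3 : (2 * μ) • (∑ b ∈ U.vars.toRight, z ^ b • pderiv (Sum.inr b) U) = 0 := by
      have e : (2 * μ) • (∑ b ∈ U.vars.toRight, z ^ b • pderiv (Sum.inr b) U) =
          ((∑ a ∈ U.vars.toLeft, z ^ a • pderiv (Sum.inl a) U) +
            μ • ∑ b ∈ U.vars.toRight, z ^ b • pderiv (Sum.inr b) U) -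
          ((∑ a ∈ U.vars.toLeft, z ^ a • pderiv (Sum.inl a) U) +
            (-μ) • ∑ b ∈ U.vars.toRight, z ^ b • pderiv (Sum.inr b) U) := by
        module
      rw [e, h1, h2, sub_zero]
    have hB : (∑ b ∈ U.vars.toRight, z ^ b • pderiv (Sum.inr b) U) = 0 := by
      rw [← inv_smul_smul₀ (mul_ne_zero two_ne_zero hμ0)
        (∑ b ∈ U.vars.toRight, z ^ b • pderiv (Sum.inr b) U), h3, smul_zero]
    refine ⟨?_, hB⟩
    simp only [hB, smul_zero, add_zero] at h1
    exact h1
  have hinf : ((↑bad : Set ℂ)ᶜ).Infinite := bad.finite_toSet.infinite_compl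
  have hq' : ∀ a ∈ U.vars.toLeft, pderiv (Sum.inl a) U = 0 := by
    refine laurent_smul_eq_zero U.vars.toLeft (fun a => pderiv (Sum.inl a) U) (hinf.mono ?_)
    intro z hz
    have hz' : z ∉ bad := fun hmem => hz (Finset.mem_coe.mpr hmem)
    exact ⟨(hgood z hz').1, (hvan z hz').1⟩
  have hp' : ∀ b ∈ U.vars.toRight, pderiv (Sum.inr b) U = 0 := by
    refine laurent_smul_eq_zero U.vars.toRight (fun b => pderiv (Sum.inr b) U) (hinf.mono ?_)
    intro z hz
    have hz' : z ∉ bad := fun hmem => hz (Finset.mem_coe.mpr hmem)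
    exact ⟨(hgood z hz').1, (hvan z hz').2⟩
  refine eq_C_of_pderiv_eq_zero U (fun i => ?_)
  by_cases hi : i ∈ U.vars
  · cases i with
    | inl a => exact hq' a (Finset.mem_toLeft.mpr hi)
    | inr b => exact hp' b (Finset.mem_toRight.mpr hi)
  · exact pderiv_eq_zero_of_notMem_vars hi

/-- Homogeneous version of the key step: under the hypotheses of `eq_C_of_planeWave_eq_zero`, a
homogeneous `U` of positive degree vanishes. [folklore] -/
theorem eq_zero_of_planeWave_eq_zero (ω : ℂ) {U : MvPolynomial (ℤ ⊕ ℤ) ℂ} {d : ℕ}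
    (hU : U.IsHomogeneous d) (hd : d ≠ 0) (F : Finset ℂ)
    (h : ∀ z μ : ℂ, z ≠ 0 → z ∉ F → μ ^ 2 = -(ω + 2 - z - z⁻¹) →
      mkDerivation ℂ (Sum.elim (fun x : ℤ => (C (z ^ x) : MvPolynomial (ℤ ⊕ ℤ) ℂ))
        (fun x : ℤ => C (μ * z ^ x))) U = 0) :
    U = 0 :=
  eq_zero_of_isHomogeneous_of_eq_C hU hd (eq_C_of_planeWave_eq_zero ω U F h)

/-- Anchor of this helper file (its registered one-line statement): the Laurent zero lemma over
`ℂ`, i.e. `laurent_coeff_eq_zero` restated verbatim. [folklore] -/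
theorem stub_harmonicSymmetries_aux1 : ∀ (S : Finset ℤ) (c : ℤ → ℂ), {z : ℂ | z ≠ 0 ∧ ∑ x ∈ S, c x * z ^ x = 0}.Infinite → ∀ x ∈ S, c x = 0 :=
  laurent_coeff_eq_zero

end Summit.AtomisticToContinuum.FouriersLaw.Theorems.DressedCharge
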